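import Literature.MathematicalPhysics.QuantumFieldTheory.Balaban1983to89.B9Eq3130GtildeTransferTower
import Literature.MathematicalPhysics.QuantumFieldTheory.Balaban1983to89.B9Eq3130RightNeumannTransferDifference

/-!
# `Balaban1983to89.B9Eq3130GtildeTransferTowerDifference` — T. Bałaban, *Propagators for lattice gauge theories in a background field*, Commun. Math. Phys. **99** (1985) 389–434
# [Balaban1985BackgroundPropagators] (3.130)–(3.131) pp. 421–422 (*«G = G₀(I − Δ′_πG₀)⁻¹»*, *«This inequality and Theorem 3.3 for G₀ imply a convergence of the series (3.130)»*),
# (3.117) p. 419, Thm 3.13 p. 426: **THE RIGHT-GROUPED (3.130) TRANSFER AT ONE HEIGHT OF THE TOWER, DIFFERENCE FORM — for ANY post-composition `X` with a row (L)(X∘G₁,k; B_X, κ₀):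
# (L)(X∘G̃_k − X∘G₁,k; (1∕(1 − qK′K′))·q·K′·B_X·K′, κ₀∕8)** — the statement and proof of the OWNER's (T4A) `B9Eq3130GtildeTransferTower.letter_transfer_tower` VERBATIM with the
# conclusion's leading `B_X +` removed and `X(G̃_kf)` replaced by `X(G̃_kf) − X(G₁,kf)` (the last line calls gen 101's `letter_right_transfer_torus_sub` instead of
# `letter_right_transfer_torus`); at `X :=` the slice derivative this is the road to the slice-gradient row of the slot difference `G̃_k − G₁,k` with the stencil smallness
# `q ∝ (ε, ε′) ∝ α`, which the π-side GRADIENT members of ROUTE (J′) need and which the left-grouped road ((K78) `transfer_pair_diff`) could only give through Hessian rows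

statement-level skeleton of published theorems with citation tags; proofs where landed; nothing here is a claim about the Yang–Mills mass gap

CITATION HEADER (lean-in-tree rule).  Audit cell `pub-balaban`, sub-cell `t4`, BINDER row NE9; filed by NE9 crux-team LEAF PROVER 01 (`b2b-balaban-t4-ne9-formalise-leaf-01`, gen 101;
ROUTE (J′), π-side; bears_on: R4/N22).  Composition BY NAME: gen 101's `B9Eq3130RightNeumannTransferDifference.letter_right_transfer_torus_sub`; everything else as in (T4A): ne9-leaf-03's
`B9Eq3130HessianSlotDifferenceTower.{G1LatticeKPi_eq_G1k_laplaceAk, laplaceAk_G1LatticeKPi_eq_dressing}` ((d′), (d″)), ne9-leaf-05's `B9Eq326G1SupRowOfLetters.{letter_comp, letter_reblock}`,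
`B9Eq33CovDerivLocalLetterTower.tdist_bigBlock_bpos_btgt_le_one`.  Source READ first-hand in the held text layer `paper:balaban1985-cmp99-background-propagators` (journal page = PDF
page + 388) pp. 419–422, 426.  NOTHING of print's proofs is reproduced: [folklore] letter algebra.

WHAT IS PROVED (sorry-free; proof lane — 0 `def`; [folklore]).
* **`letter_transfer_tower_sub`** — the binder block of (T4A) `letter_transfer_tower` VERBATIM (the eight letters `hG₀ hDsG₀ hGp hR hDGpR hDRGp hM hMt`, the row `hXG₀`, `hq`); conclusion:
  `‖(X(G̃_kf) − X(G₁,kf))(x)‖ ≤ (1∕(1 − qK′K′))·q·K′·B_X·K′·e^{−(κ₀∕8)·d_m(π₂x, v)}·F` for block-supported `f` with `‖f‖_∞ ≤ F`, `G̃_k = G1LatticeK hposπ`, `G₁,k = G1k … hpos`.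
HONEST SCOPE.  Letter algebra at one height; every letter is a HYPOTHESIS here (discharged `∃`-first in the instantiator `B9Eq3130GtildeMinusG1kGradRowsClosed`); constants crude; nothing of
[B9] (3.130)–(3.133), Thm 3.3∕3.13 or [B11] (117) asserted, valued or discharged; «NE9 ⇐ the named binders»; NE9 NOT PRINTED ∕ NOT PROVED; row WALLED ON A MODEL (O-NE9-1; #5 UNRULED); spine
PROVED 0∕9; rung (B)+1 on a finite T⁴ — NOT infinite volume, NOT mass gap, NOT BetaPertH, NOT Clay.  HONEST DEPENDENCY: continuum YM on T⁴ ⇐ BetaPertH ∧ nine spine estimates (0/9 proved);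
BetaPertH ⇐ (D1) ∧ (D4) ∧ CAP+tail; G-an2-4 gates asym, D1 and NE2/3/4.  NEW file; nothing modified.  Net new unproved facts: 0.
-/

noncomputable section

set_option autoImplicit false

open scoped InnerProductSpace ComplexConjugate BigOperators

namespace Literature.MathematicalPhysics.QuantumFieldTheory.Balaban1983to89.B9Eq3130GtildeTransferTowerDifference

open B4Sect5Torus (TSite tdist tdist_nonneg tdist_triangle tdist_self torusSum_le)
open B4Sect5Proof (latticeConst latticeConst_nonneg)
open B9SectCLatticeCarrier (Bond bpos btgt)
open B9Eq311L2Pairing (WL2)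
open B9Eq319QprimeTorus (blockCoord)
open B7Prop1Explicit (U1 Wcx boxVec)
open B11Eq103H1Complex (SiteL2K BondL2K covDerivL2K covDivL2K G1LatticeK)
open B9Eq310HessianOperator (adTransportW hessOp)
open B9Eq315QTorus (perCfg cornerSite)
open B9Eq315QTower (towerP UlevOf)
open B9Eq316TowerFlatIsOneStep (towerP_eq_fineP_pow siteCast)
open B9Eq326OperatorTower (laplaceAk G1k RofUk)
open B9Eq324DeltaPrimeATower (laplacePrimeAk GpOfUk)
open B9Eq3119DeltaPiTower (piOfUk laplaceAkPi)
open B9Eq326G1SupRowOfLetters (letter_comp letter_reblock)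
open B9Eq3130RightNeumannTransferDifference (letter_right_transfer_torus_sub)
open B9Eq3130HessianSlotDifferenceTower (G1LatticeKPi_eq_G1k_laplaceAk laplaceAk_G1LatticeKPi_eq_dressing)
open B9Eq33CovDerivLocalLetterTower (tdist_bigBlock_bpos_btgt_le_one)

/-! ## §0 Two pieces of bookkeeping -/

/-- Weakening a letter value: `B·e^{−κD}·F ≤ B′·e^{−κ′D}·F` for `0 ≤ B ≤ B′`, `κ′ ≤ κ`, `0 ≤ D`, `0 ≤ F`. [folklore] -/
private theorem weaken {B B' κ κ' D F : ℝ} (hB : 0 ≤ B) (hBB : B ≤ B') (hκ : κ' ≤ κ) (hD : 0 ≤ D) (hF : 0 ≤ F) :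
    B * Real.exp (-(κ * D)) * F ≤ B' * Real.exp (-(κ' * D)) * F := by
  refine mul_le_mul_of_nonneg_right ?_ hF
  refine mul_le_mul hBB (Real.exp_le_exp.2 ?_) (Real.exp_nonneg _) (hB.trans hBB)
  nlinarith [mul_le_mul_of_nonneg_right hκ hD]

/-! ## §1 AT ONE HEIGHT: the right-grouped transfer `letter_right_transfer_torus` instantiated at print's `G̃_k = Δ̃_{a,k}⁻¹` -/

section OneHeight

variable {d : ℕ} (L : ℕ) [NeZero L] (m : Fin d → ℕ) [∀ i, NeZero (m i)] (n : ℕ)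
  {𝔸 : Type*} [NormedRing 𝔸] [NormedAlgebra ℂ 𝔸] [CompleteSpace 𝔸] [StarRing 𝔸] [StarModule ℂ 𝔸] [NormOneClass 𝔸]
  {W : Type*} [NormedAddCommGroup W] [InnerProductSpace ℂ W] [FiniteDimensional ℂ W] (φ : W ≃ₗ[ℂ] 𝔸) {c₀ c₁ : ℝ} [Fact (0 < c₀)] [Fact (0 < c₁)]
  (τ : 𝔸 →ₗ[ℂ] ℂ) (η : ℝ) (U : Bond d (towerP L m (n + 1)) → 𝔸ˣ)
  (hRS : ∀ (b : Bond d (towerP L m (n + 1))) (v u : W), ⟪adTransportW φ U b v, u⟫_ℂ = ⟪v, adTransportW φ (fun b => (U b)⁻¹) b u⟫_ℂ)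
  (a' : ℝ) (hpos' : ∀ x : SiteL2K ℂ d (towerP L m (n + 1)) c₀ W, x ≠ 0 → 0 < RCLike.re ⟪x, laplacePrimeAk L m n φ η U a' (c₁ := c₁) x⟫_ℂ)
  (hL : 1 ≤ L) (αU : ℕ → ℝ) (hα1 : ∀ j, αU j ≤ 1 / 64)
  (hU1 : ∀ (j : ℕ) (x : B7Prop1Explicit.Site d) (κ : Fin d), perCfg (towerP L m (j + 1)) (UlevOf L m (n + 1) U j) x κ ∈ U1 𝔸)
  (hreg : ∀ (j : ℕ) (y : TSite d (towerP L m j)) (κ : Fin d) (r : Fin d → Fin L),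
    ‖((Wcx L (perCfg (towerP L m (j + 1)) (UlevOf L m (n + 1) U j)) (cornerSite L y) κ (boxVec L r) : 𝔸ˣ) : 𝔸) - 1‖ ≤ αU j)
  (a : ℝ)
  (hpos : ∀ x : BondL2K ℂ d (towerP L m (n + 1)) c₀ W, x ≠ 0 →
    0 < RCLike.re ⟪x, laplaceAk L m n φ η U hL αU hα1 hU1 hreg τ (c₀ := c₀) (c₁ := c₁) a x⟫_ℂ)
  (hposπ : ∀ x : BondL2K ℂ d (towerP L m (n + 1)) c₀ W, x ≠ 0 →
    0 < RCLike.re ⟪x, laplaceAkPi L m n φ τ η U a' hpos' hL αU hα1 hU1 hreg (c₁ := c₁) a x⟫_ℂ)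

set_option maxHeartbeats 400000 in
set_option maxRecDepth 8192 in
include hRS in
/-- **THE RIGHT-GROUPED (3.130) TRANSFER AT ONE HEIGHT OF THE TOWER, DIFFERENCE FORM** — `letter_right_transfer_torus_sub` instantiated ((T4A)'s text): `G₀ := G1k` (print's `G₀ = Δ_{a,k}⁻¹`),
`G̃ := G1LatticeK hposπ` (print's `G̃ = Δ̃_{a,k}⁻¹`), the dressing operator `𝔅 := Δ_{a,k}∘G̃` with ne9-leaf-03's (d′) `G̃ = G₀∘𝔅` and (d″) `𝔅 = 1 + K♭∘𝔅`
(`K♭ = M∘G′R∘D*G₀ + DRG′∘M†∘π_kG₀` — `hKf` holds by `rfl`), the stencils `M = Δ^η(U)∘D_U`, `M† = D*_U∘Δ^η(U)`, `G′ = G′_k`, `R = R_k`, `D = D_U`, `D* = D*_U`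
over the big blocks `Π` of `T_{L^{n+1}m}` (bonds read at `Π(b₋)`, sites at `Π`): EIGHT one-sided letters at a common rate `κ₀` in their suppliers' native shapes
(the two gradient letters of `D G′R`, `D R G′` at the TIP block `Π(b₊)` as (K70)∕(T2) state them — re-read at the base at the cost `e^{κ₀}`; `G′`, `R` separately —
composed at rate `κ₀∕2` with `K_d(κ₀∕2)`) and ANY post-composition `X` with a letter (L)(X∘G₀; B_X, κ₀) ⟹ **(L)(X∘G̃ − X∘G₀; (1∕(1 − qK′K′))·q·K′·B_X·K′, κ₀∕8)**,
`q := εB₁(B_{G′}B_RK₂)K² + ε′(B₄e^{κ₀})(B₀ + B₁(B₃e^{κ₀})K)K²`, `K₂ = K_d(κ₀∕2)`, `K = K_d(κ₀∕4)`, `K′ = K_d(κ₀∕8)`, provided `qK′K′ < 1`. [folklore]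
[cite: Balaban1985BackgroundPropagators, (3.130) p.421, Thm 3.13 p.426, Thm 3.3 p.399, Thm 3.1 (3.42) p.397] -/
theorem letter_transfer_tower_sub (hd : 1 ≤ d) (hm : ∀ i, 1 ≤ m i)
    {X₂ : Type*} [Fintype X₂] {w₂ : X₂ → ℝ} [Fact (∀ x, 0 < w₂ x)] {V₂ : Type*} [NormedAddCommGroup V₂] [InnerProductSpace ℂ V₂]
    (π₂ : X₂ → TSite d m) (X : BondL2K ℂ d (towerP L m (n + 1)) c₀ W →L[ℂ] WL2 ℂ w₂ V₂)
    {B₀ B₁ BG BR B₃ B₄ ε ε' BX κ₀ : ℝ} (hB₀ : 0 ≤ B₀) (hB₁ : 0 ≤ B₁) (hBG : 0 ≤ BG) (hBR : 0 ≤ BR) (hB₃ : 0 ≤ B₃) (hB₄ : 0 ≤ B₄) (hε : 0 ≤ ε)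
    (hε' : 0 ≤ ε') (hBX : 0 ≤ BX) (hκ₀ : 0 < κ₀)
    (hG₀ : ∀ (v : TSite d m) (f : BondL2K ℂ d (towerP L m (n + 1)) c₀ W) (F : ℝ),
      (∀ b, blockCoord (L ^ (n + 1)) m (siteCast (towerP_eq_fineP_pow L m (n + 1)) (bpos b)) ≠ v →
        WL2.equiv ℂ (fun _ : Bond d (towerP L m (n + 1)) => c₀) W f b = 0) →
      (∀ b, ‖WL2.equiv ℂ (fun _ : Bond d (towerP L m (n + 1)) => c₀) W f b‖ ≤ F) →
      ∀ b, ‖WL2.equiv ℂ (fun _ : Bond d (towerP L m (n + 1)) => c₀) W (G1k L m n φ η U hL αU hα1 hU1 hreg τ (c₀ := c₀) (c₁ := c₁) hpos f) b‖ ≤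
        B₀ * Real.exp (-(κ₀ * tdist m (blockCoord (L ^ (n + 1)) m (siteCast (towerP_eq_fineP_pow L m (n + 1)) (bpos b))) v)) * F)
    (hDsG₀ : ∀ (v : TSite d m) (f : BondL2K ℂ d (towerP L m (n + 1)) c₀ W) (F : ℝ),
      (∀ b, blockCoord (L ^ (n + 1)) m (siteCast (towerP_eq_fineP_pow L m (n + 1)) (bpos b)) ≠ v →
        WL2.equiv ℂ (fun _ : Bond d (towerP L m (n + 1)) => c₀) W f b = 0) →
      (∀ b, ‖WL2.equiv ℂ (fun _ : Bond d (towerP L m (n + 1)) => c₀) W f b‖ ≤ F) →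
      ∀ y, ‖WL2.equiv ℂ (fun _ : TSite d (towerP L m (n + 1)) => c₀) W (covDivL2K ℂ c₀ ((η : ℂ))⁻¹ (adTransportW φ fun bb => (U bb)⁻¹)
          (G1k L m n φ η U hL αU hα1 hU1 hreg τ (c₀ := c₀) (c₁ := c₁) hpos f)) y‖ ≤
        B₁ * Real.exp (-(κ₀ * tdist m (blockCoord (L ^ (n + 1)) m (siteCast (towerP_eq_fineP_pow L m (n + 1)) y)) v)) * F)
    (hGp : ∀ (v : TSite d m) (w : SiteL2K ℂ d (towerP L m (n + 1)) c₀ W) (F : ℝ),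
      (∀ x, blockCoord (L ^ (n + 1)) m (siteCast (towerP_eq_fineP_pow L m (n + 1)) x) ≠ v →
        WL2.equiv ℂ (fun _ : TSite d (towerP L m (n + 1)) => c₀) W w x = 0) →
      (∀ x, ‖WL2.equiv ℂ (fun _ : TSite d (towerP L m (n + 1)) => c₀) W w x‖ ≤ F) →
      ∀ x, ‖WL2.equiv ℂ (fun _ : TSite d (towerP L m (n + 1)) => c₀) W (GpOfUk L m n φ η U a' (c₁ := c₁) hpos' w) x‖ ≤
        BG * Real.exp (-(κ₀ * tdist m (blockCoord (L ^ (n + 1)) m (siteCast (towerP_eq_fineP_pow L m (n + 1)) x)) v)) * F)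
    (hR : ∀ (v : TSite d m) (w : SiteL2K ℂ d (towerP L m (n + 1)) c₀ W) (F : ℝ),
      (∀ x, blockCoord (L ^ (n + 1)) m (siteCast (towerP_eq_fineP_pow L m (n + 1)) x) ≠ v →
        WL2.equiv ℂ (fun _ : TSite d (towerP L m (n + 1)) => c₀) W w x = 0) →
      (∀ x, ‖WL2.equiv ℂ (fun _ : TSite d (towerP L m (n + 1)) => c₀) W w x‖ ≤ F) →
      ∀ x, ‖WL2.equiv ℂ (fun _ : TSite d (towerP L m (n + 1)) => c₀) W (RofUk L m n φ η U (c₀ := c₀) w) x‖ ≤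
        BR * Real.exp (-(κ₀ * tdist m (blockCoord (L ^ (n + 1)) m (siteCast (towerP_eq_fineP_pow L m (n + 1)) x)) v)) * F)
    (hDGpR : ∀ (v : TSite d m) (w : SiteL2K ℂ d (towerP L m (n + 1)) c₀ W) (F : ℝ),
      (∀ x, blockCoord (L ^ (n + 1)) m (siteCast (towerP_eq_fineP_pow L m (n + 1)) x) ≠ v →
        WL2.equiv ℂ (fun _ : TSite d (towerP L m (n + 1)) => c₀) W w x = 0) →
      (∀ x, ‖WL2.equiv ℂ (fun _ : TSite d (towerP L m (n + 1)) => c₀) W w x‖ ≤ F) →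
      ∀ b, ‖WL2.equiv ℂ (fun _ : Bond d (towerP L m (n + 1)) => c₀) W (covDerivL2K ℂ c₀ ((η : ℂ))⁻¹ (adTransportW φ U)
          (GpOfUk L m n φ η U a' (c₁ := c₁) hpos' (RofUk L m n φ η U (c₀ := c₀) w))) b‖ ≤
        B₃ * Real.exp (-(κ₀ * tdist m (blockCoord (L ^ (n + 1)) m (siteCast (towerP_eq_fineP_pow L m (n + 1)) (btgt b))) v)) * F)
    (hDRGp : ∀ (v : TSite d m) (w : SiteL2K ℂ d (towerP L m (n + 1)) c₀ W) (F : ℝ),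
      (∀ x, blockCoord (L ^ (n + 1)) m (siteCast (towerP_eq_fineP_pow L m (n + 1)) x) ≠ v →
        WL2.equiv ℂ (fun _ : TSite d (towerP L m (n + 1)) => c₀) W w x = 0) →
      (∀ x, ‖WL2.equiv ℂ (fun _ : TSite d (towerP L m (n + 1)) => c₀) W w x‖ ≤ F) →
      ∀ b, ‖WL2.equiv ℂ (fun _ : Bond d (towerP L m (n + 1)) => c₀) W (covDerivL2K ℂ c₀ ((η : ℂ))⁻¹ (adTransportW φ U)
          (RofUk L m n φ η U (c₀ := c₀) (GpOfUk L m n φ η U a' (c₁ := c₁) hpos' w))) b‖ ≤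
        B₄ * Real.exp (-(κ₀ * tdist m (blockCoord (L ^ (n + 1)) m (siteCast (towerP_eq_fineP_pow L m (n + 1)) (btgt b))) v)) * F)
    (hM : ∀ (v : TSite d m) (s : SiteL2K ℂ d (towerP L m (n + 1)) c₀ W) (F : ℝ),
      (∀ x, blockCoord (L ^ (n + 1)) m (siteCast (towerP_eq_fineP_pow L m (n + 1)) x) ≠ v →
        WL2.equiv ℂ (fun _ : TSite d (towerP L m (n + 1)) => c₀) W s x = 0) →
      (∀ x, ‖WL2.equiv ℂ (fun _ : TSite d (towerP L m (n + 1)) => c₀) W s x‖ ≤ F) →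
      ∀ b, ‖WL2.equiv ℂ (fun _ : Bond d (towerP L m (n + 1)) => c₀) W (hessOp φ η U τ (covDerivL2K ℂ c₀ ((η : ℂ))⁻¹ (adTransportW φ U) s)) b‖ ≤
        ε * Real.exp (-(κ₀ * tdist m (blockCoord (L ^ (n + 1)) m (siteCast (towerP_eq_fineP_pow L m (n + 1)) (bpos b))) v)) * F)
    (hMt : ∀ (v : TSite d m) (A : BondL2K ℂ d (towerP L m (n + 1)) c₀ W) (F : ℝ),
      (∀ b, blockCoord (L ^ (n + 1)) m (siteCast (towerP_eq_fineP_pow L m (n + 1)) (bpos b)) ≠ v →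
        WL2.equiv ℂ (fun _ : Bond d (towerP L m (n + 1)) => c₀) W A b = 0) →
      (∀ b, ‖WL2.equiv ℂ (fun _ : Bond d (towerP L m (n + 1)) => c₀) W A b‖ ≤ F) →
      ∀ y, ‖WL2.equiv ℂ (fun _ : TSite d (towerP L m (n + 1)) => c₀) W (covDivL2K ℂ c₀ ((η : ℂ))⁻¹ (adTransportW φ fun bb => (U bb)⁻¹)
          (hessOp φ η U τ A)) y‖ ≤
        ε' * Real.exp (-(κ₀ * tdist m (blockCoord (L ^ (n + 1)) m (siteCast (towerP_eq_fineP_pow L m (n + 1)) y)) v)) * F)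
    (hXG₀ : ∀ (v : TSite d m) (f : BondL2K ℂ d (towerP L m (n + 1)) c₀ W) (F : ℝ),
      (∀ b, blockCoord (L ^ (n + 1)) m (siteCast (towerP_eq_fineP_pow L m (n + 1)) (bpos b)) ≠ v →
        WL2.equiv ℂ (fun _ : Bond d (towerP L m (n + 1)) => c₀) W f b = 0) →
      (∀ b, ‖WL2.equiv ℂ (fun _ : Bond d (towerP L m (n + 1)) => c₀) W f b‖ ≤ F) →
      ∀ x, ‖WL2.equiv ℂ w₂ V₂ (X (G1k L m n φ η U hL αU hα1 hU1 hreg τ (c₀ := c₀) (c₁ := c₁) hpos f)) x‖ ≤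
        BX * Real.exp (-(κ₀ * tdist m (π₂ x) v)) * F)
    (hq : (ε * B₁ * (BR * BG * latticeConst d (κ₀ / 2)) * latticeConst d (κ₀ / 4) ^ 2 +
        ε' * (B₄ * Real.exp (κ₀ * 1)) * (B₀ + B₁ * (B₃ * Real.exp (κ₀ * 1)) * latticeConst d (κ₀ / 4)) * latticeConst d (κ₀ / 4) ^ 2) *
      latticeConst d (κ₀ / 8) * 1 * latticeConst d (κ₀ / 8) < 1)
    (v : TSite d m) (f : BondL2K ℂ d (towerP L m (n + 1)) c₀ W) (F : ℝ)
    (hfv : ∀ b, blockCoord (L ^ (n + 1)) m (siteCast (towerP_eq_fineP_pow L m (n + 1)) (bpos b)) ≠ v →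
      WL2.equiv ℂ (fun _ : Bond d (towerP L m (n + 1)) => c₀) W f b = 0)
    (hfF : ∀ b, ‖WL2.equiv ℂ (fun _ : Bond d (towerP L m (n + 1)) => c₀) W f b‖ ≤ F) (x : X₂) :
    ‖WL2.equiv ℂ w₂ V₂ (X (G1LatticeK hposπ f) - X (G1k L m n φ η U hL αU hα1 hU1 hreg τ (c₀ := c₀) (c₁ := c₁) hpos f)) x‖ ≤
      (1 / (1 - (ε * B₁ * (BR * BG * latticeConst d (κ₀ / 2)) * latticeConst d (κ₀ / 4) ^ 2 +
          ε' * (B₄ * Real.exp (κ₀ * 1)) * (B₀ + B₁ * (B₃ * Real.exp (κ₀ * 1)) * latticeConst d (κ₀ / 4)) * latticeConst d (κ₀ / 4) ^ 2) *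
          latticeConst d (κ₀ / 8) * 1 * latticeConst d (κ₀ / 8)) *
        (ε * B₁ * (BR * BG * latticeConst d (κ₀ / 2)) * latticeConst d (κ₀ / 4) ^ 2 +
          ε' * (B₄ * Real.exp (κ₀ * 1)) * (B₀ + B₁ * (B₃ * Real.exp (κ₀ * 1)) * latticeConst d (κ₀ / 4)) * latticeConst d (κ₀ / 4) ^ 2) *
        latticeConst d (κ₀ / 8) * BX * latticeConst d (κ₀ / 8)) *
      Real.exp (-(κ₀ / 8 * tdist m (π₂ x) v)) * F := by
  classical
  have b₀ : Bond d (towerP L m (n + 1)) := (fun _ => 0, ⟨0, hd⟩)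
  haveI : Nonempty (Bond d (towerP L m (n + 1))) := ⟨b₀⟩
  -- rates and sums
  have hδ0 := tdist_nonneg m
  have hκ : κ₀ / 4 < κ₀ / 2 := by linarith
  have hκ' : κ₀ / 8 < κ₀ / 4 := by linarith
  have hκ'' : (0 : ℝ) ≤ κ₀ / 8 := by linarith
  have hK₂ : ∀ w', ∑ u, Real.exp (-((κ₀ - κ₀ / 2) * tdist m w' u)) ≤ latticeConst d (κ₀ / 2) := fun w' => by
    have h := torusSum_le d hm (show (0 : ℝ) < κ₀ - κ₀ / 2 by linarith) w'
    rwa [show κ₀ - κ₀ / 2 = κ₀ / 2 by ring] at h ⊢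
  have hone := tdist_bigBlock_bpos_btgt_le_one L m (n + 1) hm
  -- name the CLMs
  obtain ⟨G₀, hG₀d⟩ : ∃ T : BondL2K ℂ d (towerP L m (n + 1)) c₀ W →L[ℂ] BondL2K ℂ d (towerP L m (n + 1)) c₀ W,
      T = LinearMap.toContinuousLinearMap (G1k L m n φ η U hL αU hα1 hU1 hreg τ (c₀ := c₀) (c₁ := c₁) hpos) := ⟨_, rfl⟩
  obtain ⟨Mc, hMc⟩ : ∃ T : SiteL2K ℂ d (towerP L m (n + 1)) c₀ W →L[ℂ] BondL2K ℂ d (towerP L m (n + 1)) c₀ W,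
      T = LinearMap.toContinuousLinearMap (hessOp φ η U τ ∘ₗ covDerivL2K ℂ c₀ ((η : ℂ))⁻¹ (adTransportW φ U)) := ⟨_, rfl⟩
  obtain ⟨Dc, hDc⟩ : ∃ T : SiteL2K ℂ d (towerP L m (n + 1)) c₀ W →L[ℂ] BondL2K ℂ d (towerP L m (n + 1)) c₀ W,
      T = LinearMap.toContinuousLinearMap (covDerivL2K ℂ c₀ ((η : ℂ))⁻¹ (adTransportW φ U)) := ⟨_, rfl⟩
  obtain ⟨Mtc, hMtc⟩ : ∃ T : BondL2K ℂ d (towerP L m (n + 1)) c₀ W →L[ℂ] SiteL2K ℂ d (towerP L m (n + 1)) c₀ W,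
      T = LinearMap.toContinuousLinearMap (covDivL2K ℂ c₀ ((η : ℂ))⁻¹ (adTransportW φ fun bb => (U bb)⁻¹) ∘ₗ hessOp φ η U τ) := ⟨_, rfl⟩
  obtain ⟨Dsc, hDsc⟩ : ∃ T : BondL2K ℂ d (towerP L m (n + 1)) c₀ W →L[ℂ] SiteL2K ℂ d (towerP L m (n + 1)) c₀ W,
      T = LinearMap.toContinuousLinearMap (covDivL2K ℂ c₀ ((η : ℂ))⁻¹ (adTransportW φ fun bb => (U bb)⁻¹)) := ⟨_, rfl⟩
  obtain ⟨Gpc, hGpc⟩ : ∃ T : SiteL2K ℂ d (towerP L m (n + 1)) c₀ W →L[ℂ] SiteL2K ℂ d (towerP L m (n + 1)) c₀ W,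
      T = LinearMap.toContinuousLinearMap (GpOfUk L m n φ η U a' (c₁ := c₁) hpos') := ⟨_, rfl⟩
  obtain ⟨Rc, hRc⟩ : ∃ T : SiteL2K ℂ d (towerP L m (n + 1)) c₀ W →L[ℂ] SiteL2K ℂ d (towerP L m (n + 1)) c₀ W,
      T = LinearMap.toContinuousLinearMap (RofUk L m n φ η U (c₀ := c₀)) := ⟨_, rfl⟩
  obtain ⟨Btc, hBtc⟩ : ∃ T : BondL2K ℂ d (towerP L m (n + 1)) c₀ W →L[ℂ] BondL2K ℂ d (towerP L m (n + 1)) c₀ W,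
      T = LinearMap.toContinuousLinearMap (laplaceAk L m n φ η U hL αU hα1 hU1 hreg τ (c₀ := c₀) (c₁ := c₁) a ∘ₗ G1LatticeK hposπ) := ⟨_, rfl⟩
  obtain ⟨Gtc, hGtc⟩ : ∃ T : BondL2K ℂ d (towerP L m (n + 1)) c₀ W →L[ℂ] BondL2K ℂ d (towerP L m (n + 1)) c₀ W,
      T = LinearMap.toContinuousLinearMap (G1LatticeK hposπ) := ⟨_, rfl⟩
  obtain ⟨Kf, hKf⟩ : ∃ T : BondL2K ℂ d (towerP L m (n + 1)) c₀ W →L[ℂ] BondL2K ℂ d (towerP L m (n + 1)) c₀ W,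
      T = Mc ∘L (Gpc ∘L Rc) ∘L (Dsc ∘L G₀) + (Dc ∘L Rc ∘L Gpc) ∘L Mtc ∘L (G₀ - (Dc ∘L Gpc ∘L Rc) ∘L (Dsc ∘L G₀)) := ⟨_, rfl⟩
  -- the two identities (d″), (d′)
  have hB : ∀ g, Btc g = g + Kf (Btc g) := by
    intro g
    have e := laplaceAk_G1LatticeKPi_eq_dressing L m n φ τ η U hRS a' hpos' hL αU hα1 hU1 hreg a hpos hposπ g
    simp only [piOfUk, LinearMap.sub_apply, LinearMap.id_apply, LinearMap.comp_apply] at e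
    rw [add_assoc] at e
    rw [hKf, hBtc, hMc, hDc, hMtc, hDsc, hGpc, hRc, hG₀d]
    simp only [add_apply, sub_apply, ContinuousLinearMap.comp_apply,
      LinearMap.coe_toContinuousLinearMap', LinearMap.comp_apply]
    exact e
  have hG : ∀ g, Gtc g = G₀ (Btc g) := by
    intro g
    rw [hGtc, hG₀d, hBtc]
    simp only [LinearMap.coe_toContinuousLinearMap', LinearMap.comp_apply]
    exact G1LatticeKPi_eq_G1k_laplaceAk L m n φ τ η U a' hpos' hL αU hα1 hU1 hreg a hpos hposπ g
  -- the seven letters at the CLMs, common rate `κ₀ ∕ 2`, bonds at the base block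
  have LG₀ : ∀ (v : TSite d m) (f : BondL2K ℂ d (towerP L m (n + 1)) c₀ W) (F : ℝ),
      (∀ b, blockCoord (L ^ (n + 1)) m (siteCast (towerP_eq_fineP_pow L m (n + 1)) (bpos b)) ≠ v →
        WL2.equiv ℂ (fun _ : Bond d (towerP L m (n + 1)) => c₀) W f b = 0) →
      (∀ b, ‖WL2.equiv ℂ (fun _ : Bond d (towerP L m (n + 1)) => c₀) W f b‖ ≤ F) →
      ∀ b, ‖WL2.equiv ℂ (fun _ : Bond d (towerP L m (n + 1)) => c₀) W (G₀ f) b‖ ≤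
        B₀ * Real.exp (-(κ₀ / 2 * tdist m (blockCoord (L ^ (n + 1)) m (siteCast (towerP_eq_fineP_pow L m (n + 1)) (bpos b))) v)) * F := by
    intro v f F hfv hfF b
    rw [hG₀d, LinearMap.coe_toContinuousLinearMap']
    exact (hG₀ v f F hfv hfF b).trans (weaken hB₀ le_rfl (by linarith) (hδ0 _ _) ((norm_nonneg _).trans (hfF b)))
  have LDsG₀ : ∀ (v : TSite d m) (f : BondL2K ℂ d (towerP L m (n + 1)) c₀ W) (F : ℝ),
      (∀ b, blockCoord (L ^ (n + 1)) m (siteCast (towerP_eq_fineP_pow L m (n + 1)) (bpos b)) ≠ v →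
        WL2.equiv ℂ (fun _ : Bond d (towerP L m (n + 1)) => c₀) W f b = 0) →
      (∀ b, ‖WL2.equiv ℂ (fun _ : Bond d (towerP L m (n + 1)) => c₀) W f b‖ ≤ F) →
      ∀ y, ‖WL2.equiv ℂ (fun _ : TSite d (towerP L m (n + 1)) => c₀) W ((Dsc ∘L G₀) f) y‖ ≤
        B₁ * Real.exp (-(κ₀ / 2 * tdist m (blockCoord (L ^ (n + 1)) m (siteCast (towerP_eq_fineP_pow L m (n + 1)) y)) v)) * F := by
    intro v f F hfv hfF y
    rw [ContinuousLinearMap.comp_apply, hDsc, hG₀d, LinearMap.coe_toContinuousLinearMap', LinearMap.coe_toContinuousLinearMap']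
    exact (hDsG₀ v f F hfv hfF y).trans (weaken hB₁ le_rfl (by linarith) (hδ0 _ _) ((norm_nonneg _).trans (hfF b₀)))
  have LGpR : ∀ (v : TSite d m) (w : SiteL2K ℂ d (towerP L m (n + 1)) c₀ W) (F : ℝ),
      (∀ x, blockCoord (L ^ (n + 1)) m (siteCast (towerP_eq_fineP_pow L m (n + 1)) x) ≠ v →
        WL2.equiv ℂ (fun _ : TSite d (towerP L m (n + 1)) => c₀) W w x = 0) →
      (∀ x, ‖WL2.equiv ℂ (fun _ : TSite d (towerP L m (n + 1)) => c₀) W w x‖ ≤ F) →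
      ∀ x, ‖WL2.equiv ℂ (fun _ : TSite d (towerP L m (n + 1)) => c₀) W ((Gpc ∘L Rc) w) x‖ ≤
        BR * BG * latticeConst d (κ₀ / 2) *
          Real.exp (-(κ₀ / 2 * tdist m (blockCoord (L ^ (n + 1)) m (siteCast (towerP_eq_fineP_pow L m (n + 1)) x)) v)) * F := by
    intro v w F hwv hwF x
    have h₁ : ∀ (v : TSite d m) (w : SiteL2K ℂ d (towerP L m (n + 1)) c₀ W) (F : ℝ),
        (∀ x, blockCoord (L ^ (n + 1)) m (siteCast (towerP_eq_fineP_pow L m (n + 1)) x) ≠ v →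
          WL2.equiv ℂ (fun _ : TSite d (towerP L m (n + 1)) => c₀) W w x = 0) →
        (∀ x, ‖WL2.equiv ℂ (fun _ : TSite d (towerP L m (n + 1)) => c₀) W w x‖ ≤ F) →
        ∀ x, ‖WL2.equiv ℂ (fun _ : TSite d (towerP L m (n + 1)) => c₀) W (Rc w) x‖ ≤
          BR * Real.exp (-(κ₀ * tdist m (blockCoord (L ^ (n + 1)) m (siteCast (towerP_eq_fineP_pow L m (n + 1)) x)) v)) * F := by
      intro v w F hwv hwF x; rw [hRc, LinearMap.coe_toContinuousLinearMap']; exact hR v w F hwv hwF x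
    have h₂ : ∀ (v : TSite d m) (w : SiteL2K ℂ d (towerP L m (n + 1)) c₀ W) (F : ℝ),
        (∀ x, blockCoord (L ^ (n + 1)) m (siteCast (towerP_eq_fineP_pow L m (n + 1)) x) ≠ v →
          WL2.equiv ℂ (fun _ : TSite d (towerP L m (n + 1)) => c₀) W w x = 0) →
        (∀ x, ‖WL2.equiv ℂ (fun _ : TSite d (towerP L m (n + 1)) => c₀) W w x‖ ≤ F) →
        ∀ x, ‖WL2.equiv ℂ (fun _ : TSite d (towerP L m (n + 1)) => c₀) W (Gpc w) x‖ ≤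
          BG * Real.exp (-(κ₀ * tdist m (blockCoord (L ^ (n + 1)) m (siteCast (towerP_eq_fineP_pow L m (n + 1)) x)) v)) * F := by
      intro v w F hwv hwF x; rw [hGpc, LinearMap.coe_toContinuousLinearMap']; exact hGp v w F hwv hwF x
    exact letter_comp (𝕜 := ℂ) (tdist m)
      (fun x : TSite d (towerP L m (n + 1)) => blockCoord (L ^ (n + 1)) m (siteCast (towerP_eq_fineP_pow L m (n + 1)) x))
      (fun x : TSite d (towerP L m (n + 1)) => blockCoord (L ^ (n + 1)) m (siteCast (towerP_eq_fineP_pow L m (n + 1)) x))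
      (fun x : TSite d (towerP L m (n + 1)) => blockCoord (L ^ (n + 1)) m (siteCast (towerP_eq_fineP_pow L m (n + 1)) x))
      Rc Gpc hδ0 (fun u y w' => tdist_triangle hm u y w') hBR hBG (by linarith : (0 : ℝ) ≤ κ₀ / 2) (by linarith : κ₀ / 2 ≤ κ₀) h₁ h₂ hK₂
      v w F hwv hwF x
  -- the two tip-block gradient letters, re-read at the base block (`d_m(Π(b₋), Π(b₊)) ≤ 1`), then weakened to `κ₀ ∕ 2`
  have reb : ∀ (b : Bond d (towerP L m (n + 1))) (v : TSite d m),
      tdist m (blockCoord (L ^ (n + 1)) m (siteCast (towerP_eq_fineP_pow L m (n + 1)) (bpos b))) v ≤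
        tdist m (blockCoord (L ^ (n + 1)) m (siteCast (towerP_eq_fineP_pow L m (n + 1)) (btgt b))) v + 1 := by
    intro b v
    have h := tdist_triangle hm (blockCoord (L ^ (n + 1)) m (siteCast (towerP_eq_fineP_pow L m (n + 1)) (bpos b)))
      (blockCoord (L ^ (n + 1)) m (siteCast (towerP_eq_fineP_pow L m (n + 1)) (btgt b))) v
    linarith [hone b]
  have LDGpR : ∀ (v : TSite d m) (w : SiteL2K ℂ d (towerP L m (n + 1)) c₀ W) (F : ℝ),
      (∀ x, blockCoord (L ^ (n + 1)) m (siteCast (towerP_eq_fineP_pow L m (n + 1)) x) ≠ v →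
        WL2.equiv ℂ (fun _ : TSite d (towerP L m (n + 1)) => c₀) W w x = 0) →
      (∀ x, ‖WL2.equiv ℂ (fun _ : TSite d (towerP L m (n + 1)) => c₀) W w x‖ ≤ F) →
      ∀ b, ‖WL2.equiv ℂ (fun _ : Bond d (towerP L m (n + 1)) => c₀) W ((Dc ∘L Gpc ∘L Rc) w) b‖ ≤
        B₃ * Real.exp (κ₀ * 1) *
          Real.exp (-(κ₀ / 2 * tdist m (blockCoord (L ^ (n + 1)) m (siteCast (towerP_eq_fineP_pow L m (n + 1)) (bpos b))) v)) * F := by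
    intro v w F hwv hwF b
    have h := letter_reblock (𝕜 := ℂ) (tdist m)
      (fun x : TSite d (towerP L m (n + 1)) => blockCoord (L ^ (n + 1)) m (siteCast (towerP_eq_fineP_pow L m (n + 1)) x))
      (fun b : Bond d (towerP L m (n + 1)) => blockCoord (L ^ (n + 1)) m (siteCast (towerP_eq_fineP_pow L m (n + 1)) (bpos b)))
      (Dc ∘L Gpc ∘L Rc)
      (fun b : Bond d (towerP L m (n + 1)) => blockCoord (L ^ (n + 1)) m (siteCast (towerP_eq_fineP_pow L m (n + 1)) (btgt b)))
      hB₃ hκ₀.le reb (fun v w F hwv hwF b => by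
        rw [ContinuousLinearMap.comp_apply, ContinuousLinearMap.comp_apply, hDc, hGpc, hRc, LinearMap.coe_toContinuousLinearMap',
          LinearMap.coe_toContinuousLinearMap', LinearMap.coe_toContinuousLinearMap']
        exact hDGpR v w F hwv hwF b) v w F hwv hwF b
    exact h.trans (weaken (by positivity) le_rfl (by linarith) (hδ0 _ _) ((norm_nonneg _).trans (hwF (bpos b))))
  have LDRGp : ∀ (v : TSite d m) (w : SiteL2K ℂ d (towerP L m (n + 1)) c₀ W) (F : ℝ),
      (∀ x, blockCoord (L ^ (n + 1)) m (siteCast (towerP_eq_fineP_pow L m (n + 1)) x) ≠ v →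
        WL2.equiv ℂ (fun _ : TSite d (towerP L m (n + 1)) => c₀) W w x = 0) →
      (∀ x, ‖WL2.equiv ℂ (fun _ : TSite d (towerP L m (n + 1)) => c₀) W w x‖ ≤ F) →
      ∀ b, ‖WL2.equiv ℂ (fun _ : Bond d (towerP L m (n + 1)) => c₀) W ((Dc ∘L Rc ∘L Gpc) w) b‖ ≤
        B₄ * Real.exp (κ₀ * 1) *
          Real.exp (-(κ₀ / 2 * tdist m (blockCoord (L ^ (n + 1)) m (siteCast (towerP_eq_fineP_pow L m (n + 1)) (bpos b))) v)) * F := by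
    intro v w F hwv hwF b
    have h := letter_reblock (𝕜 := ℂ) (tdist m)
      (fun x : TSite d (towerP L m (n + 1)) => blockCoord (L ^ (n + 1)) m (siteCast (towerP_eq_fineP_pow L m (n + 1)) x))
      (fun b : Bond d (towerP L m (n + 1)) => blockCoord (L ^ (n + 1)) m (siteCast (towerP_eq_fineP_pow L m (n + 1)) (bpos b)))
      (Dc ∘L Rc ∘L Gpc)
      (fun b : Bond d (towerP L m (n + 1)) => blockCoord (L ^ (n + 1)) m (siteCast (towerP_eq_fineP_pow L m (n + 1)) (btgt b)))
      hB₄ hκ₀.le reb (fun v w F hwv hwF b => by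
        rw [ContinuousLinearMap.comp_apply, ContinuousLinearMap.comp_apply, hDc, hGpc, hRc, LinearMap.coe_toContinuousLinearMap',
          LinearMap.coe_toContinuousLinearMap', LinearMap.coe_toContinuousLinearMap']
        exact hDRGp v w F hwv hwF b) v w F hwv hwF b
    exact h.trans (weaken (by positivity) le_rfl (by linarith) (hδ0 _ _) ((norm_nonneg _).trans (hwF (bpos b))))
  have LM : ∀ (v : TSite d m) (s : SiteL2K ℂ d (towerP L m (n + 1)) c₀ W) (F : ℝ),
      (∀ x, blockCoord (L ^ (n + 1)) m (siteCast (towerP_eq_fineP_pow L m (n + 1)) x) ≠ v →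
        WL2.equiv ℂ (fun _ : TSite d (towerP L m (n + 1)) => c₀) W s x = 0) →
      (∀ x, ‖WL2.equiv ℂ (fun _ : TSite d (towerP L m (n + 1)) => c₀) W s x‖ ≤ F) →
      ∀ b, ‖WL2.equiv ℂ (fun _ : Bond d (towerP L m (n + 1)) => c₀) W (Mc s) b‖ ≤
        ε * Real.exp (-(κ₀ / 2 * tdist m (blockCoord (L ^ (n + 1)) m (siteCast (towerP_eq_fineP_pow L m (n + 1)) (bpos b))) v)) * F := by
    intro v s F hsv hsF b
    rw [hMc, LinearMap.coe_toContinuousLinearMap', LinearMap.comp_apply]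
    exact (hM v s F hsv hsF b).trans (weaken hε le_rfl (by linarith) (hδ0 _ _) ((norm_nonneg _).trans (hsF (bpos b))))
  have LMt : ∀ (v : TSite d m) (A : BondL2K ℂ d (towerP L m (n + 1)) c₀ W) (F : ℝ),
      (∀ b, blockCoord (L ^ (n + 1)) m (siteCast (towerP_eq_fineP_pow L m (n + 1)) (bpos b)) ≠ v →
        WL2.equiv ℂ (fun _ : Bond d (towerP L m (n + 1)) => c₀) W A b = 0) →
      (∀ b, ‖WL2.equiv ℂ (fun _ : Bond d (towerP L m (n + 1)) => c₀) W A b‖ ≤ F) →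
      ∀ y, ‖WL2.equiv ℂ (fun _ : TSite d (towerP L m (n + 1)) => c₀) W (Mtc A) y‖ ≤
        ε' * Real.exp (-(κ₀ / 2 * tdist m (blockCoord (L ^ (n + 1)) m (siteCast (towerP_eq_fineP_pow L m (n + 1)) y)) v)) * F := by
    intro v A F hAv hAF y
    rw [hMtc, LinearMap.coe_toContinuousLinearMap', LinearMap.comp_apply]
    exact (hMt v A F hAv hAF y).trans (weaken hε' le_rfl (by linarith) (hδ0 _ _) ((norm_nonneg _).trans (hAF (y, ⟨0, hd⟩))))
  have LX : ∀ (v : TSite d m) (f : BondL2K ℂ d (towerP L m (n + 1)) c₀ W) (F : ℝ),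
      (∀ b, blockCoord (L ^ (n + 1)) m (siteCast (towerP_eq_fineP_pow L m (n + 1)) (bpos b)) ≠ v →
        WL2.equiv ℂ (fun _ : Bond d (towerP L m (n + 1)) => c₀) W f b = 0) →
      (∀ b, ‖WL2.equiv ℂ (fun _ : Bond d (towerP L m (n + 1)) => c₀) W f b‖ ≤ F) →
      ∀ x, ‖WL2.equiv ℂ w₂ V₂ ((X ∘L G₀) f) x‖ ≤ BX * Real.exp (-(κ₀ / 4 * tdist m (π₂ x) v)) * F := by
    intro v f F hfv hfF x
    rw [ContinuousLinearMap.comp_apply, hG₀d, LinearMap.coe_toContinuousLinearMap']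
    exact (hXG₀ v f F hfv hfF x).trans (weaken hBX le_rfl (by linarith) (hδ0 _ _) ((norm_nonneg _).trans (hfF b₀)))
  -- the abstract transfer
  have e1 : κ₀ / 2 - κ₀ / 4 = κ₀ / 4 := by ring
  have e2 : κ₀ / 4 - κ₀ / 8 = κ₀ / 8 := by ring
  have hB₂' : (0 : ℝ) ≤ BR * BG * latticeConst d (κ₀ / 2) := mul_nonneg (mul_nonneg hBR hBG) (latticeConst_nonneg d (by linarith))
  have hB₃' : (0 : ℝ) ≤ B₃ * Real.exp (κ₀ * 1) := mul_nonneg hB₃ (Real.exp_nonneg _)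
  have hB₄' : (0 : ℝ) ≤ B₄ * Real.exp (κ₀ * 1) := mul_nonneg hB₄ (Real.exp_nonneg _)
  have key := letter_right_transfer_torus_sub (𝕜 := ℂ)
    (fun b : Bond d (towerP L m (n + 1)) => blockCoord (L ^ (n + 1)) m (siteCast (towerP_eq_fineP_pow L m (n + 1)) (bpos b)))
    (fun x : TSite d (towerP L m (n + 1)) => blockCoord (L ^ (n + 1)) m (siteCast (towerP_eq_fineP_pow L m (n + 1)) x))
    G₀ Mc Dc Mtc Dsc Gpc Rc π₂ X hm Kf Btc Gtc hKf hB hG hB₀ hB₁ hB₂' hB₃' hB₄' hε hε' hBX hκ'' hκ' hκ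
    LG₀ LDsG₀ LGpR LDGpR LDRGp LM LMt LX (by rw [e1, e2]; exact hq) v f F hfv hfF x
  rw [e1, e2, sub_apply, ContinuousLinearMap.comp_apply, ContinuousLinearMap.comp_apply, hGtc, LinearMap.coe_toContinuousLinearMap'] at key
  rw [hG₀d, LinearMap.coe_toContinuousLinearMap'] at key
  exact key

end OneHeight


end Literature.MathematicalPhysics.QuantumFieldTheory.Balaban1983to89.B9Eq3130GtildeTransferTowerDifference

end
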